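import Summits.QuantumFields.YangMills.Theorems.ForcedResponseSkewnessRunningCouplingCeilingCovAxisDomination
import Literature.MathematicalPhysics.QuantumFieldTheory.WilsonAxisSymmetry
import HarnessLib

/-!
# Route `ForcedResponseSkewness`, crux `RunningCouplingCeiling` ⟨stmt-QuantumFields-24275⟩ — `CovToAxis` (RP-soft stub of the alternative
# skeleton line «moebius-crossover-export», ym-idea-3 g26, critic PASS by hash 2026-08-30T00:10:59Z) PROVED in its letter: ISOTROPIC pointwise
# domination of the plain plaquette covariance by the symmetrised on-axis coupling

Helper file (`--supports stmt-QuantumFields-24275`; free-hands seat `ym-line-frs-p2` g20; sequel of `…CovAxisDomination`).  Definition-free,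
0 sorry, standard axioms.  No item is closed; no summit, no crux and no mass gap is proved by this file.

WHAT.  For `x, y ∈ box L` at torus distance `d = torusDist L x y ≥ 6` there is `n` (the sup-norm of the cyclic separation, `n ≤ d ≤ 2n`) with
`d⁸ |torusCov(x,y)| ≤ 3⁸ · max(Gs(⌊n/2⌋), Gs(⌈n/2⌉))`, `Gs(t) = max((2t)⁸ lCC(Q^θ,Q,2t), (2t)⁸ lCC(Q,Q^θ,2t))` (the skeleton-local `axisGs` of
HOME `ym-idea-3/g26/line-moebius-crossover-export.lean` l.90, UNFOLDED; the stub is l.179).  Steps: §1 periodicity of `dens ∘ torusLift` and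
the cyclic representative of the separation (`torusCov x y = torusCov 0 w`, `w_k = valMinAbs(x_k − y_k)`); §2 evenness and AXIS-PERMUTATION
invariance of `torusCov 0 ·` (Literature ✓`WilsonAxisSymmetry`: `integral_comp_configPerm_wilsonMeasure`, `LatticeRep.curvature_F_perm_torusLift`
— the tree's ✓`CurvatureKernel.CovAxisNormalisation` states this in lifted letters but its module is not served by the build farm); §3 sup-norm
versus Euclidean norm on `Fin 4 → ℤ` and the `3⁸` packaging (lemmas of ym-idea-3 g26, HOME `g26/soft-stub-helpers.lean`, reproduced with credit);
§4 ★ `covToAxis` via ✓`abs_torusCov_le_of_axis_bounds`.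

[cite: OsterwalderSeiler1978, §2].  HONEST LABEL: a soft lattice lemma (reflection positivity + hypercubic symmetry); `MoebiusRow` (XL) /
`CrossoverDecay` (L–XL), ⟨24275⟩, ⟨23763⟩, ⟨26871⟩ OPEN; the Yang–Mills mass gap is NOT proved; no summit is proved by a line.
-/

set_option autoImplicit false

noncomputable section

open MeasureTheory Filter Topology
open Literature.MathematicalPhysics.QuantumFieldTheory
open Literature.MathematicalPhysics.QuantumLattice hiding torusDist
open Literature.Probability.LatticeModels (Site box)
open Summit.QuantumFields.YangMills.Cruxes.OSLegsFromFemtoAndGap.DlrCollarTransfer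
open Summit.QuantumFields.YangMills.Theorems.OSLegsFromFemtoAndGap (torusE_dens_eq_wilsonTorusMean)
open Summit.QuantumFields.YangMills.Theorems.F4SubCurvatureDoorSubCurvatureClauseMixedAxisDomination (sq_mixedKernel_le_lcc_mul_lcc)
open Summit.QuantumFields.YangMills.Cruxes.RunningCouplingCeiling.Pointwise (torusCov torusDist)
open Summit.QuantumFields.YangMills.Theorems.ForcedResponseSkewnessRunningCouplingCeilingCovAxisDomination
  (torusCov_translate torusCov_comm torusCov_eq_of_sub_eq abs_torusCov_le_of_axis_bounds)

namespace Summit.QuantumFields.YangMills.Theorems.ForcedResponseSkewnessRunningCouplingCeilingCovToAxis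

variable {G : Type} [Group G] [TopologicalSpace G] [IsTopologicalGroup G] [CompactSpace G]
  [MeasurableSpace G] [BorelSpace G]

/-! ## §1 Periodicity and the cyclic representative of the separation -/

/-- **Periodicity**: a density insertion read through the periodic lift of the torus `2L+1` only depends on its site modulo `2L+1`.
[folklore] -/
theorem dens_add_period_torusLift (r : LatticeRep G) (L : ℕ) (v u : Site 4) (U : GaugeConfig 4 (2 * L + 1) G) :
    dens G r (v + ((2 * L + 1 : ℕ) : ℤ) • u) (torusLift (2 * L + 1) U) = dens G r v (torusLift (2 * L + 1) U) := by
  unfold dens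
  congr 1
  funext e
  simp only [configShift_apply, torusLift, Function.comp_apply, torusEdge]
  congr 2
  funext k
  have hS : (2 * (L : ZMod (2 * L + 1)) + 1) = 0 := by exact_mod_cast ZMod.natCast_self (2 * L + 1)
  simp [Literature.Probability.LatticeModels.Torus.proj_apply, hS]

/-- **The covariance sees only the cyclic representative of the separation**: with `w_k = valMinAbs(x_k − y_k mod 2L+1)`,
`torusCov x y = torusCov 0 w`. [folklore] -/
theorem torusCov_eq_torusCov_zero_rep (r : LatticeRep G) (β : ℝ) (L : ℕ) (x y : Site 4) :
    torusCov G r β L x y =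
      torusCov G r β L 0 (fun k => (((x k - y k : ℤ) : ZMod (2 * L + 1))).valMinAbs) := by
  set w : Site 4 := fun k => (((x k - y k : ℤ) : ZMod (2 * L + 1))).valMinAbs with hw_def
  -- `x − y = w + (2L+1) u`
  have hdvd : ∀ k, ∃ m : ℤ, x k - y k - w k = ((2 * L + 1 : ℕ) : ℤ) * m := by
    intro k
    have h1 : ((w k : ℤ) : ZMod (2 * L + 1)) = ((x k - y k : ℤ) : ZMod (2 * L + 1)) := by
      rw [hw_def]; exact ZMod.coe_valMinAbs _
    have h2 := (ZMod.intCast_eq_intCast_iff_dvd_sub _ _ _).1 h1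
    obtain ⟨m, hm⟩ := h2
    exact ⟨m, hm⟩
  choose m hm using hdvd
  have hxy : x - y = w + ((2 * L + 1 : ℕ) : ℤ) • (fun k => m k) := by
    funext k
    simp only [Pi.sub_apply, Pi.add_apply, Pi.smul_apply, smul_eq_mul]
    linarith [hm k]
  -- `torusCov x y = torusCov y x = T(x − y) = T(w) = torusCov 0 w`
  rw [torusCov_comm, torusCov_translate, torusCov_translate r β L 0 w, sub_zero, hxy]
  have hp : (fun V => dens G r 0 V * dens G r (w + ((2 * L + 1 : ℕ) : ℤ) • (fun k => m k)) V) ∘ torusLift (2 * L + 1) =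
      (fun V => dens G r 0 V * dens G r w V) ∘ torusLift (2 * L + 1) := by
    funext U
    simp only [Function.comp_apply]
    rw [dens_add_period_torusLift]
  have hm1 : (dens G r (w + ((2 * L + 1 : ℕ) : ℤ) • (fun k => m k))) ∘ torusLift (2 * L + 1) =
      (dens G r w) ∘ torusLift (2 * L + 1) := by
    funext U
    simp only [Function.comp_apply]
    rw [dens_add_period_torusLift]
  unfold torusE
  have e1 : ∀ U : GaugeConfig 4 (2 * L + 1) G,
      dens G r 0 (torusLift (2 * L + 1) U) * dens G r (w + ((2 * L + 1 : ℕ) : ℤ) • (fun k => m k)) (torusLift (2 * L + 1) U) =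
        dens G r 0 (torusLift (2 * L + 1) U) * dens G r w (torusLift (2 * L + 1) U) := fun U => congrFun hp U
  have e2 : ∀ U : GaugeConfig 4 (2 * L + 1) G,
      dens G r (w + ((2 * L + 1 : ℕ) : ℤ) • (fun k => m k)) (torusLift (2 * L + 1) U) = dens G r w (torusLift (2 * L + 1) U) :=
    fun U => congrFun hm1 U
  simp_rw [e1, e2]

/-! ## §2 Evenness and axis-permutation invariance -/

/-- **Evenness**: `torusCov 0 (−w) = torusCov 0 w`. [folklore] -/
theorem torusCov_zero_neg (r : LatticeRep G) (β : ℝ) (L : ℕ) (w : Site 4) :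
    torusCov G r β L 0 (-w) = torusCov G r β L 0 w := by
  rw [torusCov_eq_of_sub_eq r β L (x := 0) (y := -w) (x' := w) (y' := 0) (by simp), torusCov_comm]

/-- **Axis permutations preserve the covariance**: `torusCov 0 (sitePermZd π w) = torusCov 0 w` (change of variables `U ↦ configPerm π U`
under Wilson's torus measure; the action density read on the periodic lift is permutation invariant). [folklore] -/
theorem torusCov_zero_sitePermZd (r : LatticeRep G) (β : ℝ) (L : ℕ) (π : Equiv.Perm (Fin 4)) (w : Site 4) :
    torusCov G r β L 0 (sitePermZd π w) = torusCov G r β L 0 w := by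
  unfold torusCov
  have hmeans : ∀ z : Site 4, torusE G r β L (dens G r z) = torusE G r β L (dens G r 0) := fun z => by
    rw [torusE_dens_eq_wilsonTorusMean, torusE_dens_eq_wilsonTorusMean]
  rw [hmeans (sitePermZd π w), hmeans w]
  congr 1
  unfold torusE
  have hz : sitePermZd π (0 : Site 4) = 0 := by funext j; simp
  have hperm : ∀ (v : Site 4) (U : GaugeConfig 4 (2 * L + 1) G),
      dens G r (sitePermZd π v) (torusLift (2 * L + 1) (configPerm π U)) = dens G r v (torusLift (2 * L + 1) U) := by
    intro v U
    unfold dens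
    exact LatticeRep.curvature_F_perm_torusLift r (2 * L + 1) π v U
  have hperm0 : ∀ U : GaugeConfig 4 (2 * L + 1) G,
      dens G r 0 (torusLift (2 * L + 1) (configPerm π U)) = dens G r 0 (torusLift (2 * L + 1) U) := by
    intro U
    have h := hperm 0 U
    rwa [hz] at h
  rw [← integral_comp_configPerm_wilsonMeasure (L := 2 * L + 1) r.ρ r.continuous β π
    (fun U : GaugeConfig 4 (2 * L + 1) G => dens G r 0 (torusLift (2 * L + 1) U) * dens G r (sitePermZd π w) (torusLift (2 * L + 1) U))]
  congr 1
  funext U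
  simp only []
  rw [hperm0, hperm]

/-! ## §3 Sup-norm versus Euclidean norm on `Fin 4 → ℤ`; the `3⁸` packaging (ym-idea-3 g26's helpers, reproduced) -/

/-- Sup-norm below the Euclidean norm: `|z k| ≤ √(Σ z_j²)`. [folklore] -/
theorem supCoord_le_euclid (z : Fin 4 → ℤ) (k : Fin 4) :
    ((|z k| : ℤ) : ℝ) ≤ Real.sqrt (∑ j : Fin 4, ((z j : ℤ) : ℝ) ^ 2) := by
  rw [show ((|z k| : ℤ) : ℝ) = |((z k : ℤ) : ℝ)| by push_cast; rfl, ← Real.sqrt_sq_eq_abs]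
  apply Real.sqrt_le_sqrt
  exact Finset.single_le_sum (f := fun j => ((z j : ℤ) : ℝ) ^ 2) (fun j _ => sq_nonneg _) (Finset.mem_univ k)

/-- Euclidean norm below twice the sup-norm on `Fin 4`: `√(Σ z_j²) ≤ 2·|z k|` when `k` is a maximal coordinate. [folklore] -/
theorem euclid_le_two_mul_supCoord (z : Fin 4 → ℤ) (k : Fin 4) (hk : ∀ j : Fin 4, |z j| ≤ |z k|) :
    Real.sqrt (∑ j : Fin 4, ((z j : ℤ) : ℝ) ^ 2) ≤ 2 * ((|z k| : ℤ) : ℝ) := by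
  have hk' : ∀ j : Fin 4, ((z j : ℤ) : ℝ) ^ 2 ≤ ((|z k| : ℤ) : ℝ) ^ 2 := by
    intro j
    have h2 : ((|z j| : ℤ) : ℝ) ≤ ((|z k| : ℤ) : ℝ) := by exact_mod_cast hk j
    have h3 : (0 : ℝ) ≤ ((|z j| : ℤ) : ℝ) := by exact_mod_cast abs_nonneg (z j)
    calc ((z j : ℤ) : ℝ) ^ 2 = ((|z j| : ℤ) : ℝ) ^ 2 := by push_cast; rw [sq_abs]
      _ ≤ ((|z k| : ℤ) : ℝ) ^ 2 := pow_le_pow_left₀ h3 h2 2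
  have hsum : ∑ j : Fin 4, ((z j : ℤ) : ℝ) ^ 2 ≤ 4 * ((|z k| : ℤ) : ℝ) ^ 2 := by
    calc ∑ j : Fin 4, ((z j : ℤ) : ℝ) ^ 2 ≤ ∑ _j : Fin 4, ((|z k| : ℤ) : ℝ) ^ 2 := Finset.sum_le_sum fun j _ => hk' j
      _ = 4 * ((|z k| : ℤ) : ℝ) ^ 2 := by simp
  have h0 : (0 : ℝ) ≤ ((|z k| : ℤ) : ℝ) := by exact_mod_cast abs_nonneg (z k)
  calc Real.sqrt (∑ j : Fin 4, ((z j : ℤ) : ℝ) ^ 2) ≤ Real.sqrt (4 * ((|z k| : ℤ) : ℝ) ^ 2) := Real.sqrt_le_sqrt hsum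
    _ = 2 * ((|z k| : ℤ) : ℝ) := by
      rw [show (4 : ℝ) * ((|z k| : ℤ) : ℝ) ^ 2 = (2 * ((|z k| : ℤ) : ℝ)) ^ 2 by ring]
      exact Real.sqrt_sq (by positivity)

/-- **Packaging of the axis-window bound**: `n ≤ d ≤ 2n`, `3 ≤ n`, `|K| ≤ B/(n−1)⁸` ⇒ `d⁸·|K| ≤ 3⁸·B`. [folklore] -/
theorem pow8_window_bound {d K B : ℝ} {n : ℕ} (hn : 3 ≤ n) (hnd : (n : ℝ) ≤ d) (hd2n : d ≤ 2 * n)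
    (hK : |K| ≤ B / ((n : ℝ) - 1) ^ 8) : d ^ 8 * |K| ≤ 3 ^ 8 * B := by
  have hn3 : (3 : ℝ) ≤ n := by exact_mod_cast hn
  have hm : 0 < (n : ℝ) - 1 := by linarith
  have hd0 : 0 ≤ d := le_trans (by positivity) hnd
  have hratio : d ≤ 3 * ((n : ℝ) - 1) := by linarith
  have h1 : d ^ 8 ≤ (3 * ((n : ℝ) - 1)) ^ 8 := pow_le_pow_left₀ hd0 hratio 8
  calc d ^ 8 * |K| ≤ (3 * ((n : ℝ) - 1)) ^ 8 * (B / ((n : ℝ) - 1) ^ 8) := mul_le_mul h1 hK (abs_nonneg _) (by positivity)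
    _ = 3 ^ 8 * B := by
      have : ((n : ℝ) - 1) ^ 8 ≠ 0 := by positivity
      field_simp

/-! ## §4 ★ `CovToAxis` in its letter -/

/-- ★ **`CovToAxis`** (the RP-soft stub `stub_covToAxis` of line «moebius-crossover-export» on ⟨stmt-QuantumFields-24275⟩, in its letter with
`axisGs` unfolded): for `x, y ∈ box L` at torus distance `d ≥ 6` and `β ≥ 0` there is `n` with `n ≤ d ≤ 2n` and
`d⁸ |torusCov(x,y)| ≤ 3⁸ · max(Gs(⌊n/2⌋), Gs(⌈n/2⌉))`. [cite: OsterwalderSeiler1978, §2] -/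
theorem covToAxis : ∀ (G : Type) [Group G] [TopologicalSpace G] [IsTopologicalGroup G] [CompactSpace G],
    IsCompactSimpleLieGroup G →
    letI : MeasurableSpace G := borel G
    haveI : BorelSpace G := ⟨rfl⟩
    ∀ (r : LatticeRep G) (β : ℝ), 0 ≤ β → ∀ (L : ℕ) (x y : Fin 4 → ℤ), x ∈ box 4 L → y ∈ box 4 L →
      (6 : ℝ) ≤ torusDist L x y →
        ∃ n : ℕ, (n : ℝ) ≤ torusDist L x y ∧ torusDist L x y ≤ 2 * n ∧
          torusDist L x y ^ 8 * |torusCov G r β L x y| ≤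
            3 ^ 8 * max
              (max (((2 * (n / 2) : ℕ) : ℝ) ^ 8 *
                      latticeConnectedCorr r.ρ β (2 * L + 1) r.curvature.timeReflect.F r.curvature.F (2 * (n / 2)))
                   (((2 * (n / 2) : ℕ) : ℝ) ^ 8 *
                      latticeConnectedCorr r.ρ β (2 * L + 1) r.curvature.F r.curvature.timeReflect.F (2 * (n / 2))))
              (max (((2 * ((n + 1) / 2) : ℕ) : ℝ) ^ 8 *
                      latticeConnectedCorr r.ρ β (2 * L + 1) r.curvature.timeReflect.F r.curvature.F (2 * ((n + 1) / 2)))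
                   (((2 * ((n + 1) / 2) : ℕ) : ℝ) ^ 8 *
                      latticeConnectedCorr r.ρ β (2 * L + 1) r.curvature.F r.curvature.timeReflect.F (2 * ((n + 1) / 2)))) := by
  intro G _ _ _ _ _hG
  letI : MeasurableSpace G := borel G
  haveI : BorelSpace G := ⟨rfl⟩
  intro r β hβ L x y _hx _hy hd6
  -- the cyclic representative `w` of the separation and its sup-norm `n = |w k|`
  set w : Site 4 := fun k => (((x k - y k : ℤ) : ZMod (2 * L + 1))).valMinAbs with hw_def
  have hdw : torusDist L x y = Real.sqrt (∑ j : Fin 4, ((w j : ℤ) : ℝ) ^ 2) := by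
    unfold torusDist; rfl
  obtain ⟨k, -, hk⟩ := Finset.exists_max_image Finset.univ (fun j => |w j|) ⟨(0 : Fin 4), Finset.mem_univ _⟩
  replace hk : ∀ j : Fin 4, |w j| ≤ |w k| := fun j => hk j (Finset.mem_univ _)
  set n : ℕ := (w k).natAbs with hn_def
  have hnz : (n : ℤ) = |w k| := by rw [hn_def]; exact Int.natCast_natAbs (w k)
  have hnR : (n : ℝ) = ((|w k| : ℤ) : ℝ) := by exact_mod_cast hnz
  have hnd : (n : ℝ) ≤ torusDist L x y := by rw [hnR, hdw]; exact supCoord_le_euclid w k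
  have hd2n : torusDist L x y ≤ 2 * n := by rw [hnR, hdw]; exact euclid_le_two_mul_supCoord w k hk
  have hn3 : 3 ≤ n := by
    have : (3 : ℝ) ≤ n := by linarith
    exact_mod_cast this
  have hnL : n ≤ L := by
    have h := ZMod.natAbs_valMinAbs_le (((x k - y k : ℤ) : ZMod (2 * L + 1)))
    have : (2 * L + 1) / 2 = L := by omega
    rw [this] at h
    exact h
  have hnL2 : n / 2 + 2 ≤ L := by omega
  -- put the maximal coordinate on the time axis, positively
  set w' : Site 4 := sitePermZd (Equiv.swap 0 k) w with hw'_def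
  have hw'0 : w' 0 = w k := by
    rw [hw'_def, sitePermZd_apply, Equiv.symm_swap, Equiv.swap_apply_left]
  obtain ⟨w'', hw''0, hcov⟩ : ∃ w'' : Site 4, w'' 0 = (n : ℤ) ∧ torusCov G r β L x y = torusCov G r β L 0 w'' := by
    have hxy : torusCov G r β L x y = torusCov G r β L 0 w' := by
      rw [torusCov_eq_torusCov_zero_rep, hw'_def, torusCov_zero_sitePermZd]
    by_cases hsign : 0 ≤ w k
    · refine ⟨w', ?_, hxy⟩
      rw [hw'0, hnz, abs_of_nonneg hsign]
    · refine ⟨-w', ?_, by rw [torusCov_zero_neg]; exact hxy⟩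
      rw [Pi.neg_apply, hw'0, hnz, abs_of_neg (lt_of_not_ge hsign)]
  -- the symmetric window bound `B`
  set A₁ := ((2 * (n / 2) : ℕ) : ℝ) ^ 8 *
      latticeConnectedCorr r.ρ β (2 * L + 1) r.curvature.timeReflect.F r.curvature.F (2 * (n / 2)) with hA₁
  set A₁' := ((2 * (n / 2) : ℕ) : ℝ) ^ 8 *
      latticeConnectedCorr r.ρ β (2 * L + 1) r.curvature.F r.curvature.timeReflect.F (2 * (n / 2)) with hA₁'
  set A₂ := ((2 * ((n + 1) / 2) : ℕ) : ℝ) ^ 8 *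
      latticeConnectedCorr r.ρ β (2 * L + 1) r.curvature.timeReflect.F r.curvature.F (2 * ((n + 1) / 2)) with hA₂
  set A₂' := ((2 * ((n + 1) / 2) : ℕ) : ℝ) ^ 8 *
      latticeConnectedCorr r.ρ β (2 * L + 1) r.curvature.F r.curvature.timeReflect.F (2 * ((n + 1) / 2)) with hA₂'
  set B : ℝ := max (max A₁ A₁') (max A₂ A₂') with hB_def
  have hA₁0 : 0 ≤ A₁ := by
    have h := (sq_mixedKernel_le_lcc_mul_lcc r hβ L (n / 2) (n / 2) hnL2 hnL2
      (Pi.single 0 (((n / 2 : ℕ) : ℤ) + ((n / 2 : ℕ) : ℤ))) (by simp)).2.1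
    rw [hA₁]; positivity
  have hB0 : 0 ≤ B := hA₁0.trans ((le_max_left _ _).trans (le_max_left _ _))
  have hG : A₁ ≤ B := (le_max_left _ _).trans (le_max_left _ _)
  have hG' : A₂' ≤ B := (le_max_right _ _).trans (le_max_right _ _)
  have hax := abs_torusCov_le_of_axis_bounds r hβ L n hn3 hnL2 0 w'' (Or.inl (by rw [hw''0]; simp)) hB0 hG hG'
  refine ⟨n, hnd, hd2n, ?_⟩
  rw [hcov]
  exact pow8_window_bound hn3 hnd hd2n hax

end Summit.QuantumFields.YangMills.Theorems.ForcedResponseSkewnessRunningCouplingCeilingCovToAxis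

end
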